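import Mathlib.NumberTheory.Padics.RingHoms
import Mathlib.NumberTheory.Padics.ProperSpace
import Mathlib.Topology.Algebra.ContinuousMonoidHom
import HarnessLib

/-!
# The image of a compact group in `ℤ_p` under a continuous homomorphism is `0` or `p^e ℤ_p` — PROVED

Topic `GroupTheory` (profinite groups); namespace `Literature.GroupTheory`. THEOREMS ONLY (no definition,
no named fact, no instance, no `sorry`). Cell `bsd-stepL`, seat `bsd-stepL-imc-p1` (g11): the case split
of the LOCAL-CONDITIONS module (M3c) of the tree-mapped discharge plan
`NOTE-prop323-Shapiro-discharge-plan-imc-p1-g11` ([SkinnerUrban2014] Prop. 3.2.3, Shapiro's lemma): a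
decomposition group `D_v ≤ Γ_K` maps under a `ℤ_p`-extension `κ` either to `1` (the place splits
completely in `K_∞` — module M3a `BigRepModuleShapiroLocalSplitProofs`) or ONTO `p^e ℤ_p` for some `e`
(finitely decomposed — module M3b `BigRepModuleShapiroOpenImageProofs`), because closed subgroups of
`ℤ_p` are `0` and the ideals `p^e ℤ_p`.

**`kappa_eq_one_or_exists_image_eq_span_pow`**: for a compact topological group `D` and a continuous
homomorphism `κ : D → ℤ_p` (multiplicative notation `Multiplicative ℤ_[p]`), EITHER `κ = 1` OR there is
`e : ℕ` with `κ(D) = p^e ℤ_p` exactly (`∀ g, κ g ∈ p^e ℤ_p` and every element of `p^e ℤ_p` is a value).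
Proof: `e` = the least valuation of a non-zero value (`Nat.find`); every value has valuation `≥ e`
(`PadicInt.mem_span_pow_iff_le_valuation`); a value `x₁ = u p^e` (`PadicInt.unitCoeff_spec`) gives
`ℤ x₁ ⊆ κ(D)`, whose closure `ℤ_p x₁ = p^e ℤ_p` (density of `ℤ`, `PadicInt.denseRange_intCast`) lies in the
compact, hence closed, image.

References: [SerreGaloisCohomology1997] I §1.4 (closed subgroups of `ℤ_p`); [NeukirchSchmidtWingberg2008]
(1.6.4). Elementary; nothing about number fields.
-/

noncomputable section

open Multiplicative Topology

namespace Literature.GroupTheory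

variable {p : ℕ} [hp : Fact p.Prime] {D : Type*} [Group D] [TopologicalSpace D] [CompactSpace D]

omit [CompactSpace D] in
/-- Integer multiples of a value are values: `n · κ(g) = κ(g^n)`. [cite: SerreGaloisCohomology1997, I §1.4] -/
theorem toAdd_map_zpow_eq (κ : D →ₜ* Multiplicative ℤ_[p]) (g : D) (n : ℤ) :
    toAdd (κ (g ^ n)) = (n : ℤ_[p]) * toAdd (κ g) := by
  rw [map_zpow, toAdd_zpow, zsmul_eq_mul]

/-- **Closed subgroups of `ℤ_p`: the image of a compact group under a continuous homomorphism to `ℤ_p`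
is trivial or exactly `p^e ℤ_p`.** [cite: SerreGaloisCohomology1997, I §1.4 (pro-`p` groups; subgroups of `ℤ_p`)] -/
theorem kappa_eq_one_or_exists_image_eq_span_pow (κ : D →ₜ* Multiplicative ℤ_[p]) :
    (∀ g : D, κ g = 1) ∨
      ∃ e : ℕ, (∀ g : D, toAdd (κ g) ∈ Ideal.span {(p : ℤ_[p]) ^ e}) ∧
        ∀ y ∈ Ideal.span {(p : ℤ_[p]) ^ e}, ∃ g : D, toAdd (κ g) = y := by
  classical
  by_cases htriv : ∀ g : D, κ g = 1
  · exact Or.inl htriv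
  right
  simp only [not_forall] at htriv
  -- the least valuation `e` of a non-zero value
  have hex : ∃ e : ℕ, ∃ g : D, toAdd (κ g) ≠ 0 ∧ (toAdd (κ g)).valuation = e := by
    obtain ⟨g, hg⟩ := htriv
    exact ⟨_, g, fun h ↦ hg (by rw [← ofAdd_toAdd (κ g), h, ofAdd_zero]), rfl⟩
  set e := Nat.find hex with he
  obtain ⟨g₁, hg₁, hval₁⟩ := Nat.find_spec hex
  have hmin : ∀ g : D, toAdd (κ g) ≠ 0 → e ≤ (toAdd (κ g)).valuation := fun g hg ↦
    Nat.find_min' hex ⟨g, hg, rfl⟩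
  refine ⟨e, fun g ↦ ?_, fun y hy ↦ ?_⟩
  · -- every value lies in `p^e ℤ_p`
    by_cases h0 : toAdd (κ g) = 0
    · rw [h0]; exact Ideal.zero_mem _
    · exact (PadicInt.mem_span_pow_iff_le_valuation _ h0 e).2 (hmin g h0)
  · -- `p^e ℤ_p = ℤ_p · x₁ ⊆ closure (ℤ · x₁) ⊆ κ(D)` (compact, hence closed)
    set x₁ : ℤ_[p] := toAdd (κ g₁) with hx₁
    have hS : IsClosed (Set.range fun g : D ↦ toAdd (κ g)) :=
      (isCompact_range (continuous_toAdd.comp κ.continuous_toFun)).isClosed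
    -- `y = x₁ * t` for some `t ∈ ℤ_p`
    obtain ⟨w, rfl⟩ := Ideal.mem_span_singleton'.1 hy
    have hx₁eq : x₁ = (PadicInt.unitCoeff hg₁ : ℤ_[p]) * (p : ℤ_[p]) ^ e := by
      rw [he, ← hval₁]; exact PadicInt.unitCoeff_spec hg₁
    set t : ℤ_[p] := w * ((PadicInt.unitCoeff hg₁)⁻¹ : ℤ_[p]ˣ) with ht
    have hyt : w * (p : ℤ_[p]) ^ e = x₁ * t := by
      have hu : ((PadicInt.unitCoeff hg₁ : ℤ_[p]ˣ) : ℤ_[p]) * ((PadicInt.unitCoeff hg₁)⁻¹ : ℤ_[p]ˣ) = 1 :=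
        Units.mul_inv _
      rw [hx₁eq, ht]
      linear_combination (-(w * (p : ℤ_[p]) ^ e)) * hu
    rw [hyt]
    -- `x₁ * t ∈ closure {x₁ * n : n ∈ ℤ} ⊆ range`
    have hsub : (fun s : ℤ_[p] ↦ x₁ * s) '' Set.range (Int.cast : ℤ → ℤ_[p]) ⊆
        Set.range fun g : D ↦ toAdd (κ g) := by
      rintro _ ⟨_, ⟨n, rfl⟩, rfl⟩
      exact ⟨g₁ ^ n, show toAdd (κ (g₁ ^ n)) = x₁ * (n : ℤ_[p]) by rw [toAdd_map_zpow_eq, mul_comm]⟩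
    have hmem : x₁ * t ∈ closure ((fun s : ℤ_[p] ↦ x₁ * s) '' Set.range (Int.cast : ℤ → ℤ_[p])) := by
      refine image_closure_subset_closure_image (continuous_const.mul continuous_id) ⟨t, ?_, rfl⟩
      rw [(PadicInt.denseRange_intCast (p := p)).closure_range]
      exact Set.mem_univ t
    obtain ⟨g, hg⟩ := hS.closure_subset_iff.2 hsub hmem
    exact ⟨g, hg⟩

end Literature.GroupTheory

end
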